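import Mathlib
import Literature.Probability.Distributions.GaussianSphereMarginal
import Literature.Probability.Distributions.ComplexGaussianVectors
import Literature.Probability.RandomMatrix.ComplexGaussianNormSq
import HarnessLib

/-!
# Small-ball bound for the ratio of two independent Gaussian norms

For independent standard Gaussian vectors `x ∈ E₁`, `y ∈ E₂` (finite-dimensional real inner
product spaces of dimensions `d₁, d₂ ≥ 1`) and `c ≥ 0`,

  `P(‖x‖² ≤ c ‖y‖²) ≤ c^{d₁/2} · Γ((d₁+d₂)/2) / (Γ(d₁/2 + 1) Γ(d₂/2))`

(`stdGaussian_prod_measure_normSq_le`); for complex coordinate spaces `ℂ^d × ℂ^n` the constant is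
the binomial coefficient `C(d+n-1, d)` (`stdGaussian_prod_measure_normSq_le_choose`). Ingredients:
the `χ²` law of `‖x‖²` (`map_norm_sq_stdGaussian` of the tree), the Gamma lower-tail bound
`P(Gamma(a,r) ≤ s) ≤ (rs)^a/Γ(a+1)` (`gammaMeasure_Iic_le`) and the Gamma moments
`E[X^k] = Γ(a+k)/(Γ(a) r^k)` (`lintegral_gammaPDF_mul_rpow_rate`). This is the one-column
probabilistic input of the column-by-column small-ball bound for Haar unitaries
(`EguchiKawaiDirectionLadderHaarNestedPattern*`). All [folklore].
-/

noncomputable section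

open MeasureTheory ProbabilityTheory Set Real Module Filter
open Literature.Probability.Distributions (map_norm_sq_stdGaussian)
open Literature.Probability.RandomMatrix (measurable_gammaPDF)
open scoped ENNReal

namespace Summit.QuantumFields.YangMills.Theorems.EguchiKawaiDirectionLadder.HaarColumns

/-! ### Gamma lower tail and moments -/

/-- **Gamma lower tail**: `P(Gamma(a,r) ≤ s) ≤ (r s)^a / Γ(a+1)` for `a, r > 0`, `s ≥ 0`
(drop the factor `e^{-rx} ≤ 1` in the density and integrate `x^{a-1}`). [folklore] -/
theorem gammaMeasure_Iic_le {a r s : ℝ} (ha : 0 < a) (hr : 0 < r) (hs : 0 ≤ s) :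
    gammaMeasure a r (Iic s) ≤ ENNReal.ofReal ((r * s) ^ a / Real.Gamma (a + 1)) := by
  have hΓ : 0 < Real.Gamma a := Real.Gamma_pos_of_pos ha
  have hC : 0 ≤ r ^ a / Real.Gamma a := by positivity
  rw [gammaMeasure, withDensity_apply _ measurableSet_Iic,
    lintegral_Iic_eq_lintegral_Iio_add_Icc _ hs, lintegral_gammaPDF_of_nonpos le_rfl, zero_add]
  -- drop the exponential factor
  have hle : ∫⁻ x in Icc 0 s, gammaPDF a r x ≤
      ∫⁻ x in Icc 0 s, ENNReal.ofReal (r ^ a / Real.Gamma a * x ^ (a - 1)) := by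
    refine setLIntegral_mono' measurableSet_Icc fun x hx => ?_
    rw [gammaPDF_of_nonneg hx.1]
    refine ENNReal.ofReal_le_ofReal ?_
    have hx1 : Real.exp (-(r * x)) ≤ 1 := by
      rw [Real.exp_le_one_iff]; nlinarith [hx.1, hr.le]
    have h0 : 0 ≤ r ^ a / Real.Gamma a * x ^ (a - 1) :=
      mul_nonneg hC (Real.rpow_nonneg hx.1 _)
    calc r ^ a / Real.Gamma a * x ^ (a - 1) * Real.exp (-(r * x))
        ≤ r ^ a / Real.Gamma a * x ^ (a - 1) * 1 := mul_le_mul_of_nonneg_left hx1 h0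
      _ = _ := mul_one _
  refine hle.trans ?_
  -- evaluate `∫_{[0,s]} x^{a-1} dx = s^a / a`
  have hint : IntegrableOn (fun x : ℝ => r ^ a / Real.Gamma a * x ^ (a - 1)) (Icc 0 s) := by
    have h1 : IntervalIntegrable (fun x : ℝ => x ^ (a - 1)) volume 0 s :=
      intervalIntegral.intervalIntegrable_rpow' (by linarith)
    rw [intervalIntegrable_iff_integrableOn_Icc_of_le hs] at h1
    exact h1.const_mul _
  have hnn : 0 ≤ᵐ[volume.restrict (Icc (0:ℝ) s)] fun x : ℝ => r ^ a / Real.Gamma a * x ^ (a - 1) := by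
    rw [Filter.EventuallyLE, ae_restrict_iff' measurableSet_Icc]
    exact ae_of_all _ fun x hx => mul_nonneg hC (Real.rpow_nonneg hx.1 _)
  rw [← ofReal_integral_eq_lintegral_ofReal hint hnn]
  refine ENNReal.ofReal_le_ofReal (le_of_eq ?_)
  rw [integral_Icc_eq_integral_Ioc, ← intervalIntegral.integral_of_le hs,
    intervalIntegral.integral_const_mul, integral_rpow (Or.inl (by linarith))]
  rw [show a - 1 + 1 = a by ring, Real.zero_rpow ha.ne', sub_zero, Real.Gamma_add_one ha.ne',
    Real.mul_rpow hr.le hs]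
  field_simp

/-- `gammaPDF a r x · x^k = Γ(a+k)/(Γ(a) r^k) · gammaPDF (a+k) r x` for `x > 0`. [folklore] -/
theorem gammaPDF_mul_rpow_rate {a k r : ℝ} (ha : 0 < a) (hk : 0 ≤ k) (hr : 0 < r) {x : ℝ}
    (hx : 0 < x) :
    gammaPDF a r x * ENNReal.ofReal (x ^ k) =
      ENNReal.ofReal (Real.Gamma (a + k) / (Real.Gamma a * r ^ k)) * gammaPDF (a + k) r x := by
  have hΓa := Real.Gamma_pos_of_pos ha
  have hΓak := Real.Gamma_pos_of_pos (by linarith : 0 < a + k)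
  have hX : 0 ≤ r ^ a / Real.Gamma a * x ^ (a - 1) * Real.exp (-(r * x)) := by positivity
  have hY : 0 ≤ Real.Gamma (a + k) / (Real.Gamma a * r ^ k) := by positivity
  rw [gammaPDF_of_nonneg hx.le, gammaPDF_of_nonneg hx.le, ← ENNReal.ofReal_mul hX,
    ← ENNReal.ofReal_mul hY]
  congr 1
  have hrk : 0 < r ^ k := Real.rpow_pos_of_pos hr k
  rw [show a + k - 1 = (a - 1) + k by ring, Real.rpow_add hx, Real.rpow_add hr]
  field_simp

/-- **Gamma moments with a rate**: `∫ gammaPDF a r x · x^k dx = Γ(a+k)/(Γ(a) r^k)`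
(`a, r > 0`, `k ≥ 0`). [folklore] -/
theorem lintegral_gammaPDF_mul_rpow_rate {a k r : ℝ} (ha : 0 < a) (hk : 0 ≤ k) (hr : 0 < r) :
    ∫⁻ x, gammaPDF a r x * ENNReal.ofReal (x ^ k) =
      ENNReal.ofReal (Real.Gamma (a + k) / (Real.Gamma a * r ^ k)) := by
  have hsplit : ∀ (b : ℝ) (F : ℝ → ℝ≥0∞),
      ∫⁻ s, gammaPDF b r s * F s = ∫⁻ s in Ioi 0, gammaPDF b r s * F s := by
    intro b F
    rw [← lintegral_add_compl _ measurableSet_Ici, compl_Ici]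
    have h0 : ∫⁻ s in Iio 0, gammaPDF b r s * F s = 0 := by
      rw [setLIntegral_congr_fun measurableSet_Iio (fun s (hs : s < 0) => by
        rw [gammaPDF_of_neg hs, zero_mul]), lintegral_zero]
    rw [h0, add_zero, setLIntegral_congr Ioi_ae_eq_Ici]
  rw [hsplit, setLIntegral_congr_fun measurableSet_Ioi
      (fun x (hx : 0 < x) => gammaPDF_mul_rpow_rate ha hk hr hx),
    lintegral_const_mul _ (measurable_gammaPDF _ _)]
  have h1 : ∫⁻ x in Ioi 0, gammaPDF (a + k) r x = 1 := by
    have := hsplit (a + k) (fun _ => 1)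
    simp only [mul_one] at this
    rw [← this, lintegral_gammaPDF_eq_one (by linarith) hr]
  rw [h1, mul_one]

/-! ### The ratio of two independent Gaussian norms -/

section Real

variable {E₁ E₂ : Type*}
  [NormedAddCommGroup E₁] [InnerProductSpace ℝ E₁] [FiniteDimensional ℝ E₁] [MeasurableSpace E₁]
  [BorelSpace E₁] [NormedAddCommGroup E₂] [InnerProductSpace ℝ E₂] [FiniteDimensional ℝ E₂]
  [MeasurableSpace E₂] [BorelSpace E₂]

omit [InnerProductSpace ℝ E₁] [FiniteDimensional ℝ E₁] in
/-- The event `‖x‖² ≤ c ‖y‖²` is closed, hence measurable. [folklore] -/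
theorem measurableSet_normSq_le_mul_normSq (c : ℝ) :
    MeasurableSet {p : E₁ × E₂ | ‖p.1‖ ^ 2 ≤ c * ‖p.2‖ ^ 2} := by
  refine (isClosed_le ?_ ?_).measurableSet <;> fun_prop

/-- **Small-ball bound for the Gaussian norm ratio.** For independent standard Gaussian vectors
`x ∈ E₁`, `y ∈ E₂` (`dim E₁ = d₁ ≥ 1`, `dim E₂ = d₂ ≥ 1`) and `c ≥ 0`:
`P(‖x‖² ≤ c‖y‖²) ≤ c^{d₁/2} Γ((d₁+d₂)/2) / (Γ(d₁/2+1) Γ(d₂/2))`. Conditionally on `y` the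
probability is a `χ²_{d₁}` lower tail `≤ (c‖y‖²/2)^{d₁/2}/Γ(d₁/2+1)`, and
`E[(‖y‖²)^{d₁/2}] = 2^{d₁/2} Γ((d₁+d₂)/2)/Γ(d₂/2)`. [folklore] -/
theorem stdGaussian_prod_measure_normSq_le [Nontrivial E₁] [Nontrivial E₂] {c : ℝ} (hc : 0 ≤ c) :
    ((stdGaussian E₁).prod (stdGaussian E₂)) {p : E₁ × E₂ | ‖p.1‖ ^ 2 ≤ c * ‖p.2‖ ^ 2} ≤
      ENNReal.ofReal (c ^ ((finrank ℝ E₁ : ℝ) / 2) *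
        (Real.Gamma ((finrank ℝ E₁ : ℝ) / 2 + (finrank ℝ E₂ : ℝ) / 2) /
          (Real.Gamma ((finrank ℝ E₁ : ℝ) / 2 + 1) * Real.Gamma ((finrank ℝ E₂ : ℝ) / 2)))) := by
  set a : ℝ := (finrank ℝ E₁ : ℝ) / 2 with ha
  set b : ℝ := (finrank ℝ E₂ : ℝ) / 2 with hb
  have ha0 : 0 < a := by
    rw [ha]; exact div_pos (Nat.cast_pos.2 (finrank_pos (R := ℝ) (M := E₁))) two_pos
  have hb0 : 0 < b := by
    rw [hb]; exact div_pos (Nat.cast_pos.2 (finrank_pos (R := ℝ) (M := E₂))) two_pos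
  have hlaw₁ := (map_norm_sq_stdGaussian (F := E₁)).1
  have hlaw₂ := (map_norm_sq_stdGaussian (F := E₂)).1
  rw [← ha] at hlaw₁
  rw [← hb] at hlaw₂
  -- integrate over `y` first
  rw [Measure.prod_apply_symm (measurableSet_normSq_le_mul_normSq c)]
  -- the conditional bound
  have hcond : ∀ y : E₂, stdGaussian E₁ ((fun x : E₁ => (x, y)) ⁻¹'
      {p : E₁ × E₂ | ‖p.1‖ ^ 2 ≤ c * ‖p.2‖ ^ 2}) ≤
        ENNReal.ofReal ((c / 2) ^ a / Real.Gamma (a + 1)) * ENNReal.ofReal ((‖y‖ ^ 2) ^ a) := by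
    intro y
    have hset : (fun x : E₁ => (x, y)) ⁻¹' {p : E₁ × E₂ | ‖p.1‖ ^ 2 ≤ c * ‖p.2‖ ^ 2} =
        (fun x : E₁ => ‖x‖ ^ 2) ⁻¹' Iic (c * ‖y‖ ^ 2) := by
      ext x; simp
    rw [hset, ← Measure.map_apply (by fun_prop) measurableSet_Iic, hlaw₁]
    refine (gammaMeasure_Iic_le ha0 (by norm_num) (by positivity)).trans (le_of_eq ?_)
    rw [← ENNReal.ofReal_mul (by positivity)]
    congr 1
    rw [show (1 / 2 : ℝ) * (c * ‖y‖ ^ 2) = (c / 2) * ‖y‖ ^ 2 by ring,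
      Real.mul_rpow (by positivity) (by positivity)]
    ring
  refine (lintegral_mono hcond).trans ?_
  rw [lintegral_const_mul _ (by fun_prop)]
  -- the moment `E[(‖y‖²)^a]`
  have hmom : ∫⁻ y, ENNReal.ofReal ((‖y‖ ^ 2) ^ a) ∂(stdGaussian E₂) =
      ENNReal.ofReal (Real.Gamma (b + a) / (Real.Gamma b * (1 / 2 : ℝ) ^ a)) := by
    have h1 : ∫⁻ y, ENNReal.ofReal ((‖y‖ ^ 2) ^ a) ∂(stdGaussian E₂) =
        ∫⁻ t, ENNReal.ofReal (t ^ a) ∂((stdGaussian E₂).map fun y : E₂ => ‖y‖ ^ 2) := by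
      rw [lintegral_map (by fun_prop) (by fun_prop)]
    rw [h1, hlaw₂, gammaMeasure, lintegral_withDensity_eq_lintegral_mul _
      (measurable_gammaPDF _ _) (show Measurable fun t : ℝ => ENNReal.ofReal (t ^ a) by fun_prop)]
    exact lintegral_gammaPDF_mul_rpow_rate hb0 ha0.le (by norm_num)
  rw [hmom, ← ENNReal.ofReal_mul (by positivity)]
  refine ENNReal.ofReal_le_ofReal (le_of_eq ?_)
  have hΓ1 : 0 < Real.Gamma (a + 1) := Real.Gamma_pos_of_pos (by linarith)
  have hΓb : 0 < Real.Gamma b := Real.Gamma_pos_of_pos hb0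
  have h2a : (0 : ℝ) < (1 / 2 : ℝ) ^ a := Real.rpow_pos_of_pos (by norm_num) a
  rw [Real.div_rpow hc zero_le_two, show (2 : ℝ) ^ a = ((1 / 2 : ℝ) ^ a)⁻¹ by
    rw [← Real.inv_rpow (by norm_num)]; norm_num, add_comm b a]
  field_simp

end Real

/-! ### Complex coordinate spaces -/

/-- The real dimension of `ℂ^ι` is `2|ι|`. [folklore] -/
theorem finrank_real_euclideanSpace_complex (ι : Type*) [Fintype ι] :
    finrank ℝ (EuclideanSpace ℂ ι) = 2 * Fintype.card ι := by
  rw [finrank_real_of_complex, finrank_euclideanSpace]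

/-- **Complex form.** For independent standard Gaussian vectors `x ∈ ℂ^d`, `y ∈ ℂ^n`
(`d, n ≥ 1`) and `c ≥ 0`: `P(‖x‖² ≤ c‖y‖²) ≤ c^d · C(d+n-1, d)`. [folklore] -/
theorem stdGaussian_prod_measure_normSq_le_choose {d n : ℕ} (hd : 1 ≤ d) (hn : 1 ≤ n) {c : ℝ}
    (hc : 0 ≤ c) :
    ((stdGaussian (EuclideanSpace ℂ (Fin d))).prod (stdGaussian (EuclideanSpace ℂ (Fin n))))
        {p | ‖p.1‖ ^ 2 ≤ c * ‖p.2‖ ^ 2} ≤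
      ENNReal.ofReal (c ^ d * ((d + n - 1).choose d : ℝ)) := by
  haveI : Nontrivial (EuclideanSpace ℂ (Fin d)) := by
    haveI : Nonempty (Fin d) := ⟨⟨0, hd⟩⟩; infer_instance
  haveI : Nontrivial (EuclideanSpace ℂ (Fin n)) := by
    haveI : Nonempty (Fin n) := ⟨⟨0, hn⟩⟩; infer_instance
  refine (stdGaussian_prod_measure_normSq_le (E₁ := EuclideanSpace ℂ (Fin d))
    (E₂ := EuclideanSpace ℂ (Fin n)) hc).trans (le_of_eq ?_)
  congr 1
  have h1 : (finrank ℝ (EuclideanSpace ℂ (Fin d)) : ℝ) / 2 = d := by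
    rw [finrank_real_euclideanSpace_complex, Fintype.card_fin]; push_cast; ring
  have h2 : (finrank ℝ (EuclideanSpace ℂ (Fin n)) : ℝ) / 2 = n := by
    rw [finrank_real_euclideanSpace_complex, Fintype.card_fin]; push_cast; ring
  rw [h1, h2, Real.rpow_natCast]
  congr 1
  -- `Γ(d+n)/(Γ(d+1)Γ(n)) = (d+n-1)!/(d!(n-1)!) = C(d+n-1, d)`
  obtain ⟨n', rfl⟩ : ∃ n', n = n' + 1 := ⟨n - 1, by omega⟩
  have hdn : ((d : ℝ) + ((n' + 1 : ℕ) : ℝ)) = ((d + n' : ℕ) : ℝ) + 1 := by push_cast; ring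
  rw [hdn, show ((n' + 1 : ℕ) : ℝ) = (n' : ℝ) + 1 by push_cast; ring,
    Real.Gamma_nat_eq_factorial, Real.Gamma_nat_eq_factorial, Real.Gamma_nat_eq_factorial,
    show d + (n' + 1) - 1 = d + n' by omega, Nat.choose_eq_factorial_div_factorial (by omega),
    show d + n' - d = n' by omega, Nat.cast_div (Nat.factorial_mul_factorial_dvd_factorial_add d n')
      (by positivity)]
  push_cast
  ring

end Summit.QuantumFields.YangMills.Theorems.EguchiKawaiDirectionLadder.HaarColumns

end
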